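import Summits.PneNP.PneNP.Theses.UniformStream
import Literature.Computability.Complexity.StackWordArith

/-!
# `UniformStreamLB` (crux stmt-PneNP-16045, route `UniformStream`) — negative-side support, part 3:
# time-constructibility (`n ≤ s n`) is load-bearing AGAINST VACUOUS TRUTH (refuter crux-attack seat)

`UniformStreamLB := ∃ s, IsTimeConstructible s ∧ ∀ c, ¬ ∃ A M₀ M₁ M₂, …`. Drop `IsTimeConstructible s`
(indeed just its half `∀ n, n ≤ s n`) and the statement becomes TRUE for a silly reason: at `s = 0`
every budget is the CONSTANT `0^c + c`, while the init machine `M₀` — ONE Mathlib `TM2` machine for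
all `N` — must reach the halting configuration from the numeral `encodeNat N` (length `⌊log₂ N⌋ + 1`)
within that many steps; but one `TM2` step runs one `Stmt` tree and therefore pops at most a
machine constant `D` of symbols from the input stack (`popBound`,
`length_input_le_of_outputsWithin`: `OutputsWithin l l' m → |l| ≤ D·m + |l'|`). So for `s = 0` the
uniform class is EMPTY and `∀ c, ¬ ∃ …` holds vacuously (`uniformStreamLB_vacuous_without_tc`).

Moral: the crux's content lives entirely in the window `n ≤ s n < univBound n` (part 2,
`LargeSizeNoWitness.lean`, bounds it from above); MMW's side condition `s(n) ≥ n`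
(McKay–Murray–Williams, STOC 2019, Thm. 1.3, p. 3) is exactly what rules the empty class out, since
then every budget `s(⌊log₂N⌋)^c + c ≥ ⌊log₂N⌋ + 1` (c ≥ 1) lets a machine read the numeral of `N`.
Sorry-free; this file does NOT refute the crux.
-/

noncomputable section

set_option linter.dupNamespace false

open Turing Computability
open Literature.Computability.Complexity Literature.Computability.MetaComplexity

namespace Summit.PneNP.PneNP.Theorems.UniformStreamLB.Negative

section PopBound

variable {K : Type} [DecidableEq K] {Γ : K → Type} {Λ σ : Type}

/-- The number of `pop`s of stack `k` that ONE execution of a statement can perform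
(maximum over branches). [folklore] -/
def popBound (k : K) : TM2.Stmt Γ Λ σ → ℕ
  | TM2.Stmt.push _ _ q => popBound k q
  | TM2.Stmt.peek _ _ q => popBound k q
  | TM2.Stmt.pop k' _ q => (if k' = k then 1 else 0) + popBound k q
  | TM2.Stmt.load _ q => popBound k q
  | TM2.Stmt.branch _ q₁ q₂ => max (popBound k q₁) (popBound k q₂)
  | TM2.Stmt.goto _ => 0
  | TM2.Stmt.halt => 0

/-- One statement execution shortens stack `k` by at most `popBound k q`. [folklore] -/
theorem length_le_stepAux (k : K) (q : TM2.Stmt Γ Λ σ) (v : σ) (S : ∀ k, List (Γ k)) :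
    (S k).length ≤ ((TM2.stepAux q v S).stk k).length + popBound k q := by
  induction q generalizing v S with
  | push k' f q ih =>
    refine le_trans ?_ (ih v (Function.update S k' (f v :: S k')))
    rcases eq_or_ne k k' with rfl | hne
    · simp
    · rw [Function.update_of_ne hne]
  | peek k' f q ih => exact ih _ _
  | pop k' f q ih =>
    have h1 := ih (f v (S k').head?) (Function.update S k' (S k').tail)
    have h2 : (S k).length ≤ (Function.update S k' (S k').tail k).length + (if k' = k then 1 else 0) := by
      rcases eq_or_ne k' k with rfl | hne
      · simp only [Function.update_self, List.length_tail, if_true]; omega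
      · rw [Function.update_of_ne (Ne.symm hne), if_neg hne]; omega
    simp only [TM2.stepAux, popBound]
    omega
  | load f q ih => exact ih _ _
  | branch f q₁ q₂ ih₁ ih₂ =>
    simp only [TM2.stepAux, popBound]
    cases f v
    · exact (ih₂ v S).trans (by simp)
    · exact (ih₁ v S).trans (by simp)
  | goto f => simp [TM2.stepAux, popBound]
  | halt => simp [TM2.stepAux, popBound]

end PopBound

/-- A machine constant bounding the pops of the input stack per step. [folklore] -/
def machinePopBound (tm : FinTM2) : ℕ :=
  (@Finset.univ tm.Λ tm.ΛFin).sup fun l => popBound tm.k₀ (tm.m l)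

/-- Along `n` steps of a run the input stack loses at most `n · machinePopBound` symbols. [folklore] -/
theorem length_le_of_iterate (tm : FinTM2) (n : ℕ) (c c' : tm.Cfg)
    (h : (flip bind tm.step)^[n] (some c) = some c') :
    (c.stk tm.k₀).length ≤ (c'.stk tm.k₀).length + n * machinePopBound tm := by
  induction n generalizing c with
  | zero =>
    simp only [Function.iterate_zero, id_eq, Option.some.injEq] at h
    subst h; simp
  | succ n ih =>
    rw [Function.iterate_succ_apply] at h
    rcases c with ⟨_ | l, v, S⟩
    · -- halted configurations do not move
      have hnone : ∀ j, (flip bind tm.step)^[j] (none : Option tm.Cfg) = none := by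
        intro j; induction j with
        | zero => rfl
        | succ j ihj => rw [Function.iterate_succ_apply]; exact ihj
      have : (flip bind tm.step) (some (⟨none, v, S⟩ : tm.Cfg)) = none := rfl
      rw [this, hnone] at h
      exact absurd h (by simp)
    · have hstep : (flip bind tm.step) (some (⟨some l, v, S⟩ : tm.Cfg)) =
          some (TM2.stepAux (tm.m l) v S) := rfl
      rw [hstep] at h
      have h1 := ih _ h
      have h2 := length_le_stepAux tm.k₀ (tm.m l) v S
      have h3 : popBound tm.k₀ (tm.m l) ≤ machinePopBound tm :=
        Finset.le_sup (f := fun l => popBound tm.k₀ (tm.m l)) (@Finset.mem_univ tm.Λ tm.ΛFin l)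
      show (S tm.k₀).length ≤ _
      rw [Nat.succ_mul]
      omega

/-- **Input length versus time**: a machine that halts with output `l'` within `m` steps has read
an input of length at most `D·m + |l'|`, `D` a machine constant (the halting configuration has the
input stack empty, or equal to the output if the two stacks coincide). [folklore] -/
theorem length_input_le_of_outputsWithin {Γ₀ Γ₁ : Type} (M : TM2ComputableAux Γ₀ Γ₁)
    (l : List Γ₀) (l' : List Γ₁) (m : ℕ) (h : M.OutputsWithin l l' m) :
    l.length ≤ machinePopBound M.tm * m + l'.length := by
  obtain ⟨⟨⟨n, hn⟩, hle⟩⟩ := h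
  have hrun := length_le_of_iterate M.tm n _ _ hn
  -- the input stack of the initial configuration carries the whole input
  have hinit : ∀ (L : List (M.tm.Γ M.tm.k₀)) (k : M.tm.K), k = M.tm.k₀ →
      L.length ≤ ((initList M.tm L).stk k).length := by
    intro L k hk
    unfold initList
    dsimp only
    split
    · subst hk; simp
    · exact absurd hk ‹_›
  -- the input stack of the halting configuration is empty or the output
  have hhalt : ∀ (L : List (M.tm.Γ M.tm.k₁)) (k : M.tm.K),
      ((haltList M.tm L).stk k).length ≤ L.length := by
    intro L k
    unfold haltList
    dsimp only
    split
    · rename_i hk; subst hk; simp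
    · simp
  have h1 := hinit (l.map M.inputAlphabet.symm) M.tm.k₀ rfl
  have h2 := hhalt (l'.map M.outputAlphabet.symm) M.tm.k₀
  simp only [List.length_map] at h1 h2
  have h3 : n * machinePopBound M.tm ≤ machinePopBound M.tm * m := by
    rw [mul_comm]; exact Nat.mul_le_mul_left _ hle
  omega

/-- **Without time-constructibility the crux is vacuously true.** Dropping `IsTimeConstructible s`
from `UniformStreamLB`, the size function `s = 0` is a witness: every budget is the constant
`0^c + c`, and no single init machine `M₀` consumes the numerals `encodeNat N` (length `⌊log₂N⌋+1`,
unbounded) within constantly many steps (`length_input_le_of_outputsWithin`; the output `init N`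
has length `≤ 0^c + c` by the space bound). Only `M₀` and `HasSpace` are used. [folklore] -/
theorem uniformStreamLB_vacuous_without_tc :
    ∃ s : ℕ → ℕ, ∀ c : ℕ, ¬ ∃ (A : StreamingAlgorithm) (M₀ M₁ M₂ : TM2ComputableAux Bool Bool),
      A.HasSpace (fun N => s (Nat.log 2 N) ^ c + c) ∧
      (∀ N : ℕ, M₀.OutputsWithin (encodeNat N) (A.init N) (s (Nat.log 2 N) ^ c + c)) ∧
      (∀ (N : ℕ) (st : List Bool) (b : Bool), st.length ≤ s (Nat.log 2 N) ^ c + c →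
        M₁.OutputsWithin (boolPair st [b]) (A.update N st b) (s (Nat.log 2 N) ^ c + c)) ∧
      (∀ (N : ℕ) (st : List Bool), st.length ≤ s (Nat.log 2 N) ^ c + c →
        M₂.OutputsWithin st (encodeBool (A.accept N st)) (s (Nat.log 2 N) ^ c + c)) ∧
      A.Decides (MCSPSize s) := by
  refine ⟨fun _ => 0, fun c => ?_⟩
  rintro ⟨A, M₀, M₁, M₂, hspace, hinit, -, -, -⟩
  set b := (0 : ℕ) ^ c + c with hb
  set D := machinePopBound M₀.tm with hD
  -- the numeral of N = 2^(D·b + b) has length D·b + b + 1, one more than the machine can read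
  have hN := length_input_le_of_outputsWithin M₀ _ _ _ (hinit (2 ^ (D * b + b)))
  have hsp := (hspace (2 ^ (D * b + b))).1
  rw [Com.encodeNat_two_pow, List.length_append, List.length_replicate, List.length_singleton] at hN
  change (A.init (2 ^ (D * b + b))).length ≤ b at hsp
  change D * b + b + 1 ≤ D * b + (A.init (2 ^ (D * b + b))).length at hN
  omega

end Summit.PneNP.PneNP.Theorems.UniformStreamLB.Negative

end
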